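import Mathlib
import Summits.HodgeConjecture.FermatCycles.HodgeFermatHypUTailOddA

/-!
# HypUTailOdd — the tail of LEMMA S at ALL odd squarefree levels, part 2: `goodTail` (`HodgeFermat/HypUTailOdd.lean`; HF-G25)

Tree copy (part 2 of 2) of the module `HodgeFermat/HypUTailOdd.lean` of the sibling cell's standalone package
`run/shared/lean/pub/pub-hodgefermat/lean/HodgeFermat/` (488 lines, sha256 `cc21e8ab7ebf622d…`), source lines 222–488 (§§4–6: the many-factor sum, the key inequality, `goodTail`, `goodTail_100000`).
Filed by cell `pub-hfermat`, seat prover-1 gen-3, on the COORDINATOR KEEPER RULING of 2026-08-25 (gem sweep H1: take the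
off-gate kernel theorem `thmFstar` through the gate) — here THEOREM F* of `tables/DPRIME-THEOREM.md` §9 IN FULL, i.e.
PROPOSITION D′(3N) and the descent (`HodgeFermat/PropDPrimeNFinal.lean`, GATE HF-G34), the last off-gate form of THEOREM F*
(its first two forms, `DecodingFinal.thmFstar` = F* at the prime levels and `ThmFstarNFinal.thmFstar` = F*(3N), landed on
2026-08-25 as `HodgeFermatThmFstar.lean` / `HodgeFermatThmFstarN.lean`, seats prover-1 gen-0 / gen-2); this file is one link of
the import closure of `PropDPrimeNFinal.propDprime` (the sibling's KR-free chain: THEOREM L, COROLLARY M, THEOREM D6,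
THEOREM U⁺, THEOREM KR6, THEOREM Z3U) on top of those landed chains.  The source module is the sibling's hub-checked module of
record (pub-hodgefermat `CERT.md` l.906, GATE HF-G25; cell record `check/HypUTailOdd_standalone.lean` sha256 `2946650e39e5a462…`); its declarations are copied VERBATIM.
Deviations from the source module, exhaustively: the `import` lines (tree modules `Summits.HodgeConjecture.FermatCycles.
HodgeFermat*` instead of `HodgeFermat.*`); this module docstring; the `set_option`/namespace/`open` preamble (source l.32–36) is repeated at the top because the module is split; QUALIFIED-NAME SUBSTITUTIONS (name resolution only, forced by the DEDUP deletions in `HodgeFermatHypUTailQA/B.lean`): the source's references to the deleted restated copies `HypUTailQ.le_foldr_min` (l.134), `HypUTailQ.foldr_min_le_mem` (l.184), `HypUTailQ.sum_range_eq_list` (l.215), `HypUTailQ.log_le_orderOf` (l.421), `HypUTailQ.list_sum_map_range` (l.469) now name the landed twins `HypVTail.…` (same statements), and `HypUTailQ.harmonic_cast_le` (l.238, 252) names `Literature.NumberTheory.LFunctions.VKZeta.sum_range_inv_succ_le'`; nothing else in those lines changes; DEDUP (pre-empting the gate's `dedup.landed`): the source's `theorem prod_range_eq_list` (l.313–315)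 restates the landed `HodgeFermat.KRFree.HypVTail.prod_range_eq_list` (`HodgeFermatHypVTailA.lean`, imported through `HodgeFermatHypUTailQA`) VERBATIM and is DELETED, re-bound by the added line `open HodgeFermat.KRFree.HypVTail (prod_range_eq_list)`; one-line docstrings added (gate lint) to `list_prod_range`. The module docstring is quoted in full in part 1.
Every other line — in particular every declaration's statement and proof — is byte-identical to the source.
HONEST FRAMING: explicit algebraic cycles for specific Hodge classes on Fermat/Delsarte varieties; residual open instances
listed; no claim on general Hodge.  (This file is arithmetic of CM types / finite combinatorics / analytic number theory
of the sibling's KR-free programme; it claims nothing about cycles.)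
-/

set_option autoImplicit false

namespace HodgeFermat.KRFree.HypUOdd

open Finset HodgeFermat.KRFree.HypBReduction

open HodgeFermat.KRFree.HypVTail (prod_range_eq_list)

/-! ## §5 The many-factor regime (`k ≥ 25`) -/

/-- `∑_{i<k} 3 / ((i+1)(k-i)) < 1` for `k ≥ 25`. -/
theorem many_factor_sum (k : ℕ) (hk : 25 ≤ k) :
    ∑ i ∈ range k, (3 : ℝ) / (((i : ℝ) + 1) * ((k : ℝ) - i)) < 1 := by
  have hk0 : (0 : ℝ) < (k : ℝ) + 1 := by positivity
  have hpf : ∀ i ∈ range k, (3 : ℝ) / (((i : ℝ) + 1) * ((k : ℝ) - i)) =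
      3 / ((k : ℝ) + 1) * (1 / ((i : ℝ) + 1) + 1 / ((k : ℝ) - i)) := by
    intro i hi
    have hik : (i : ℝ) < k := by exact_mod_cast mem_range.mp hi
    have h1 : ((k : ℝ) - i) ≠ 0 := by linarith
    have h2 : ((i : ℝ) + 1) ≠ 0 := by positivity
    field_simp
    ring
  rw [sum_congr rfl hpf, ← mul_sum, sum_add_distrib]
  have hA : ∑ i ∈ range k, (1 : ℝ) / ((i : ℝ) + 1) ≤ 1 + Real.log ((k : ℝ) + 1) := by
    have h1 := Literature.NumberTheory.LFunctions.VKZeta.sum_range_inv_succ_le' k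
    have h2 : Real.log (k : ℝ) ≤ Real.log ((k : ℝ) + 1) :=
      Real.log_le_log (by exact_mod_cast (show 0 < k by omega)) (by linarith)
    linarith
  have hB : ∑ i ∈ range k, (1 : ℝ) / ((k : ℝ) - i) ≤ 1 + Real.log ((k : ℝ) + 1) := by
    have href : ∑ i ∈ range k, (1 : ℝ) / ((k : ℝ) - i) = ∑ j ∈ range k, (1 : ℝ) / ((j : ℝ) + 1) := by
      rw [← Finset.sum_range_reflect (fun j => (1 : ℝ) / ((j : ℝ) + 1)) k]
      apply sum_congr rfl
      intro i hi
      have hik : i < k := mem_range.mp hi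
      have : ((k - 1 - i : ℕ) : ℝ) = (k : ℝ) - 1 - i := by
        rw [Nat.cast_sub (by omega), Nat.cast_sub (by omega)]; push_cast; ring
      rw [this]; ring
    rw [href]
    have h1 := Literature.NumberTheory.LFunctions.VKZeta.sum_range_inv_succ_le' k
    have h2 : Real.log (k : ℝ) ≤ Real.log ((k : ℝ) + 1) :=
      Real.log_le_log (by exact_mod_cast (show 0 < k by omega)) (by linarith)
    linarith
  have hlog := HypUTailQ.log_le_lin ((k : ℝ) + 1) (by positivity)
  have hk' : (25 : ℝ) ≤ k := by exact_mod_cast hk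
  rw [div_mul_eq_mul_div, div_lt_one hk0]
  nlinarith

/-! ## §6 The numeric key lemma -/

/-- KEY LEMMA: for odd naturals `p i ≥ qt i` and `d i ≥ max (⌊log_{p i} (L k)⌋, k - i)` (`i < k`),
`∑_{i<k} 6 / ((p i - 1) · d i) < 1`. -/
theorem key (k : ℕ) (hk : 0 < k) (p d : ℕ → ℕ) (hp : ∀ i < k, qt i ≤ p i)
    (hpo : ∀ i < k, p i % 2 = 1) (hd1 : ∀ i < k, Nat.log (p i) (L k) ≤ d i)
    (hd2 : ∀ i < k, k - i ≤ d i) :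
    ∑ i ∈ range k, (6 : ℝ) / ((((p i - 1 : ℕ) : ℝ)) * (d i : ℝ)) < 1 := by
  by_cases hk25 : k < 25
  · have hfin : (bnd k : ℝ) < 1 := by exact_mod_cast bnd_lt_one k hk25 hk
    rw [bnd_cast] at hfin
    refine lt_of_le_of_lt (sum_le_sum (fun i hi => ?_)) hfin
    have hik : i < k := mem_range.mp hi
    have hqi := qt_ge i
    have hD : Dmin (L k) (starts k) (qt i) (k - i) ≤ (p i - 1) * max (Nat.log (p i) (L k)) (k - i) :=
      den_ge _ _ (bands_ok k hk25) _ _ _ (by omega) (qt_odd i) (hpo i hik) (hp i hik)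
    have hmax : max (Nat.log (p i) (L k)) (k - i) ≤ d i := max_le (hd1 i hik) (hd2 i hik)
    have hD' : Dmin (L k) (starts k) (qt i) (k - i) ≤ (p i - 1) * d i :=
      le_trans hD (Nat.mul_le_mul le_rfl hmax)
    have hpos : 0 < Dmin (L k) (starts k) (qt i) (k - i) :=
      lt_of_lt_of_le (Nat.mul_pos (by omega) (by omega)) (Dmin_ge _ _ (qt i) (k - i))
    have hD'' : (Dmin (L k) (starts k) (qt i) (k - i) : ℝ) ≤ ((p i - 1 : ℕ) : ℝ) * (d i : ℝ) := by
      exact_mod_cast hD'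
    exact div_le_div_of_nonneg_left (by norm_num) (by exact_mod_cast hpos) hD''
  · push Not at hk25
    refine lt_of_le_of_lt (sum_le_sum (fun i hi => ?_)) (many_factor_sum k hk25)
    have hik : i < k := mem_range.mp hi
    have h1 : (2 * (i : ℝ) + 2) ≤ ((p i - 1 : ℕ) : ℝ) := by
      have := hp i hik
      have hqi := qt_ge i
      have : 2 * i + 2 ≤ p i - 1 := by omega
      exact_mod_cast this
    have h2 : ((k : ℝ) - i) ≤ (d i : ℝ) := by
      have := hd2 i hik
      have : ((k - i : ℕ) : ℝ) ≤ d i := by exact_mod_cast this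
      rwa [Nat.cast_sub hik.le] at this
    have hki : (0 : ℝ) < (k : ℝ) - i := by
      have : (i : ℝ) < k := by exact_mod_cast hik
      linarith
    have hi1 : (0 : ℝ) < (i : ℝ) + 1 := by positivity
    calc (6 : ℝ) / (((p i - 1 : ℕ) : ℝ) * (d i : ℝ))
        ≤ 6 / ((2 * (i : ℝ) + 2) * ((k : ℝ) - i)) := by
          apply div_le_div_of_nonneg_left (by norm_num) (by positivity)
          exact mul_le_mul h1 h2 hki.le (by positivity)
      _ = 3 / (((i : ℝ) + 1) * ((k : ℝ) - i)) := by
          field_simp; ring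

/-! ## §7 The tail theorem -/

/-- the exponent floor used for the prime factor `p` of `N` (`S = N.primeFactors`, `Lv = L #S`). -/
def dd (Lv : ℕ) (S : Finset ℕ) (p : ℕ) : ℕ := max (Nat.log p Lv) (S.filter (fun q => p ≤ q)).card


/-- a list product as a `Finset.range` product over `getD` -/
theorem list_prod_range (l : List ℕ) : l.prod = ∏ i ∈ range l.length, l.getD i 0 := by
  induction l with
  | nil => simp
  | cons x l ih =>
      rw [List.prod_cons, List.length_cons, Finset.prod_range_succ']
      simp only [List.getD_cons_succ, List.getD_cons_zero]
      rw [ih]; ring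

/-- THE TAIL: the level inequality at every odd squarefree level beyond the threshold of its number of
prime factors (`3 ∣ N` allowed). -/
theorem goodTail (N : ℕ) (hsq : Squarefree N) (h2 : ¬ 2 ∣ N)
    (hX : XK N.primeFactors.card < N) :
    6 * ∑ p ∈ N.primeFactors, tau N p < N.totient := by
  have hN0 : N ≠ 0 := by omega
  have hN : 1 < N := by
    by_contra h
    have h1 : N = 1 := by omega
    subst h1
    simp [XK] at hX
  set S := N.primeFactors with hS
  have hprod : ∏ q ∈ S, q = N := Nat.prod_primeFactors_of_squarefree hsq
  have hmemS : ∀ p ∈ S, p.Prime ∧ p ∣ N := fun p hp =>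
    ⟨Nat.prime_of_mem_primeFactors hp, Nat.dvd_of_mem_primeFactors hp⟩
  have hge3 : ∀ p ∈ S, 3 ≤ p ∧ p % 2 = 1 := by
    intro p hp
    obtain ⟨hpr, hdvd⟩ := hmemS p hp
    have hp2 : p ≠ 2 := fun h => h2 (h ▸ hdvd)
    have hodd : p % 2 = 1 := hpr.eq_two_or_odd.resolve_left hp2
    have := hpr.two_le
    exact ⟨by omega, hodd⟩
  have hcop : ∀ p ∈ S, Nat.Coprime p (N / p) := by
    intro p hp
    obtain ⟨hpr, hdvd⟩ := hmemS p hp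
    rw [Nat.Prime.coprime_iff_not_dvd hpr]
    intro hdiv
    have hpp : p * p ∣ N := by
      have := Nat.mul_dvd_mul_left p hdiv
      rwa [Nat.mul_div_cancel' hdvd] at this
    have hu := hsq p hpp
    rw [Nat.isUnit_iff] at hu
    exact absurd hu hpr.one_lt.ne'
  have htot : ∀ p ∈ S, (N.totient : ℝ) = ((p : ℝ) - 1) * ((N / p).totient : ℝ) := by
    intro p hp
    obtain ⟨hpr, hdvd⟩ := hmemS p hp
    have h := Nat.totient_mul (hcop p hp)
    rw [Nat.mul_div_cancel' hdvd, Nat.totient_prime hpr] at h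
    rw [h]; push_cast [Nat.cast_sub hpr.one_lt.le]; ring
  have hbN : ∀ p ∈ S, p ^ (S.filter (fun q => p ≤ q)).card ≤ N := by
    intro p hp
    calc p ^ (S.filter (fun q => p ≤ q)).card ≤ ∏ q ∈ S.filter (fun q => p ≤ q), q :=
          Finset.pow_card_le_prod _ _ _ (fun q hq => (Finset.mem_filter.mp hq).2)
      _ ≤ ∏ q ∈ S, q := Finset.prod_le_prod_of_subset_of_one_le' (Finset.filter_subset _ _)
          (fun q hq _ => (hmemS q hq).1.one_lt.le)
      _ = N := hprod
  -- the sorted list of prime factors and the size bound `L k ≤ N`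
  set l := S.sort (fun a b => a ≤ b) with hl
  set k := l.length with hk
  have hkS : k = S.card := by rw [hk, hl, Finset.length_sort]
  have hSne : S.Nonempty := Nat.nonempty_primeFactors.mpr hN
  have hk0 : 0 < k := by rw [hkS]; exact Finset.card_pos.mpr hSne
  have hgetD : ∀ i, (hi : i < k) → l.getD i 0 = l.get ⟨i, by omega⟩ := by
    intro i hi
    rw [List.getD_eq_getElem l 0 hi]; rfl
  have hmem : ∀ i, i < k → l.getD i 0 ∈ S := by
    intro i hi
    rw [hgetD i hi]
    exact (Finset.mem_sort (fun a b => a ≤ b)).mp (List.get_mem l _)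
  have hmono : ∀ i j, i < j → j < k → l.getD i 0 < l.getD j 0 := by
    intro i j hij hjk
    have hsm : StrictMono l.get := Finset.sortedLT_sort S
    rw [hgetD i (by omega), hgetD j hjk]
    exact hsm (show (⟨i, by omega⟩ : Fin l.length) < ⟨j, by omega⟩ from hij)
  have hpf : ∀ i, i < k → qt i ≤ l.getD i 0 := by
    intro i
    induction i with
    | zero => intro h0; have := (hge3 _ (hmem 0 h0)).1; rw [qt_zero]; exact this
    | succ i ih =>
        intro hi
        exact qt_step i _ _ (ih (by omega)) (hmono i (i + 1) (by omega) hi)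
          (hge3 _ (hmem i (by omega))).2 (hge3 _ (hmem (i + 1) hi)).2 (hmemS _ (hmem (i + 1) hi)).1
  have hlN : l.prod = N := by
    have h1 : l.prod = S.toList.prod := (Finset.sort_perm_toList S (fun a b => a ≤ b)).prod_eq
    have h2 : (S.toList.map (fun q => q)).prod = ∏ q ∈ S, q := Finset.prod_map_toList S (fun q => q)
    rw [List.map_id'] at h2
    rw [h1, h2, hprod]
  have hQN : Q k ≤ N := by
    calc Q k = ∏ i ∈ range k, qt i := (prod_range_eq_list qt k).symm
      _ ≤ ∏ i ∈ range k, l.getD i 0 :=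
          Finset.prod_le_prod' (fun i hi => hpf i (mem_range.mp hi))
      _ = l.prod := (list_prod_range l).symm
      _ = N := hlN
  have hLN : L k ≤ N := by
    have hXk : XK k < N := by rw [hkS]; exact hX
    exact max_le hXk.le (le_trans (min_le_left _ _) hQN)
  -- exponent floors and orders
  have hdpos : ∀ p ∈ S, 0 < dd (L k) S p := by
    intro p hp
    have : 0 < (S.filter (fun q => p ≤ q)).card :=
      Finset.card_pos.mpr ⟨p, Finset.mem_filter.mpr ⟨hp, le_rfl⟩⟩
    exact lt_of_lt_of_le this (le_max_right _ _)
  have hdo : ∀ p ∈ S, dd (L k) S p ≤ orderOf ((p : ℕ) : ZMod (N / p)) := by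
    intro p hp
    obtain ⟨hpr, hdvd⟩ := hmemS p hp
    have hm0 : 0 < N / p := Nat.div_pos (Nat.le_of_dvd (by omega) hdvd) hpr.pos
    have h1 := HypVTail.log_le_orderOf p (N / p) hpr (hcop p hp) hm0
    rw [Nat.mul_div_cancel' hdvd] at h1
    refine le_trans (max_le ?_ ?_) h1
    · exact Nat.log_mono_right hLN
    · exact Nat.le_log_of_pow_le hpr.one_lt (hbN p hp)
  -- one term
  have hterm : ∀ p ∈ S, (6 : ℝ) * (tau N p : ℝ) ≤
      (N.totient : ℝ) * (6 / ((((p - 1 : ℕ) : ℝ)) * (dd (L k) S p : ℝ))) := by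
    intro p hp
    obtain ⟨hpr, hdvd⟩ := hmemS p hp
    have ht := HypUTailQ.tau_le N p (dd (L k) S p) (hdpos p hp) (hdo p hp)
    have hp1 : (0 : ℝ) < (p : ℝ) - 1 := by
      have : (2 : ℝ) ≤ p := by exact_mod_cast hpr.two_le
      linarith
    have hdp : (0 : ℝ) < (dd (L k) S p : ℝ) := by exact_mod_cast hdpos p hp
    rw [htot p hp, Nat.cast_sub hpr.one_lt.le, Nat.cast_one]
    have e : ((p : ℝ) - 1) * ((N / p).totient : ℝ) * (6 / (((p : ℝ) - 1) * (dd (L k) S p : ℝ))) =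
        6 * (((N / p).totient : ℝ) / (dd (L k) S p : ℝ)) := by
      field_simp
    rw [e]
    linarith
  -- ranks
  have hcard : ∀ i, i < k → k - i ≤ (S.filter (fun q => l.getD i 0 ≤ q)).card := by
    intro i hi
    rw [← Nat.card_Ico i k]
    apply Finset.card_le_card_of_injOn (fun j => l.getD j 0)
    · intro j hj
      have hj' := Finset.mem_Ico.mp (Finset.mem_coe.mp hj)
      refine Finset.mem_coe.mpr (Finset.mem_filter.mpr ⟨hmem j hj'.2, ?_⟩)
      rcases Nat.eq_or_lt_of_le hj'.1 with h | h
      · rw [h]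
      · exact (hmono i j h hj'.2).le
    · intro j₁ hj₁ j₂ hj₂ heq
      have h1 := (Finset.mem_Ico.mp (Finset.mem_coe.mp hj₁)).2
      have h2 := (Finset.mem_Ico.mp (Finset.mem_coe.mp hj₂)).2
      rcases lt_trichotomy j₁ j₂ with h | h | h
      · exact absurd heq (ne_of_lt (hmono _ _ h h2))
      · exact h
      · exact absurd heq.symm (ne_of_lt (hmono _ _ h h1))
  have hkey := key k hk0 (fun i => l.getD i 0) (fun i => dd (L k) S (l.getD i 0)) hpf
    (fun i hi => (hge3 _ (hmem i hi)).2)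
    (fun i _ => le_max_left _ _) (fun i hi => le_trans (hcard i hi) (le_max_right _ _))
  have hsum : ∑ p ∈ S, (6 : ℝ) / ((((p - 1 : ℕ) : ℝ)) * (dd (L k) S p : ℝ)) =
      ∑ i ∈ range k, (6 : ℝ) / ((((l.getD i 0 - 1 : ℕ) : ℝ)) * (dd (L k) S (l.getD i 0) : ℝ)) := by
    have h1 : ∑ p ∈ S, (6 : ℝ) / ((((p - 1 : ℕ) : ℝ)) * (dd (L k) S p : ℝ)) =
        (l.map (fun p => (6 : ℝ) / ((((p - 1 : ℕ) : ℝ)) * (dd (L k) S p : ℝ)))).sum := by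
      rw [← Finset.sum_map_toList S]
      exact (List.Perm.map _ (Finset.sort_perm_toList S (fun a b => a ≤ b))).sum_eq.symm
    rw [h1, HypVTail.list_sum_map_range]
  rw [← hsum] at hkey
  have htotpos : (0 : ℝ) < (N.totient : ℝ) := by
    exact_mod_cast Nat.totient_pos.mpr (by omega)
  have hfinal : (6 : ℝ) * ∑ p ∈ S, (tau N p : ℝ) < (N.totient : ℝ) := by
    calc (6 : ℝ) * ∑ p ∈ S, (tau N p : ℝ) = ∑ p ∈ S, 6 * (tau N p : ℝ) := by rw [mul_sum]
      _ ≤ ∑ p ∈ S, (N.totient : ℝ) * (6 / ((((p - 1 : ℕ) : ℝ)) * (dd (L k) S p : ℝ))) :=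
          sum_le_sum hterm
      _ = (N.totient : ℝ) * ∑ p ∈ S, (6 / ((((p - 1 : ℕ) : ℝ)) * (dd (L k) S p : ℝ))) := by
          rw [← mul_sum]
      _ < (N.totient : ℝ) * 1 := mul_lt_mul_of_pos_left hkey htotpos
      _ = (N.totient : ℝ) := mul_one _
  exact_mod_cast hfinal

/-- In particular beyond `10⁵` no hypothesis on the number of prime factors remains. -/
theorem goodTail_100000 (N : ℕ) (hsq : Squarefree N) (h2 : ¬ 2 ∣ N) (hN : 100000 < N) :
    6 * ∑ p ∈ N.primeFactors, tau N p < N.totient :=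
  goodTail N hsq h2 (lt_of_le_of_lt (XK_le _) hN)

end HodgeFermat.KRFree.HypUOdd
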